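import Literature.NumberTheory.Sieve.HeathBrownCubicTypeIIErrorEV
import Literature.NumberTheory.Sieve.HeathBrownMorozClassFamily
import HarnessLib

/-!
# Crux `HeathBrownMorozUniform` (stmt-Parity-19915), line `unit-split-positivity`: stub E3 `stub_classMainError`

Heath-Brown, Acta Math. 186 (2001), §11 p. 67 / (11.2) — passage to generators and Möbius inversion over
`gcd(x, y)`, `S_V = M_V + E_V`, `E_V ≪ X^{2−τ/2}(log X)^c` — for the CLASS sum
`S_V^{cl} = bilin (classPairs X η d a₀ b₀) pairIdeal c g` of Heath-Brown–Moroz 2004, Prop. 4.2 (ii), (4.5):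
the class filter `x ≡ a₀, y ≡ b₀ (mod d)` rides along (`classPairs = (box.filter cls).filter coprime`), the
main term is `∑_{(x,y) ∈ box, cls} Hprim(x,y)`, and the class error is dominated termwise by the tree's
d = 1 majorant `9 ∑_{box, gcd ≥ X^τ} τ(γ)² τ(gcd)`, whence the same absolute bound (Lemma 4.7 + the
elementary gcd count, verbatim the tree's `exists_errorEV_bound`). The final theorem `stub_classMainError`
is the registered signature of the merged skeleton `Cruxes/HeathBrownMorozUniform/Lines/unit_split_positivity.lean`
VERBATIM.

## References

* D. R. Heath-Brown, Acta Math. 186 (2001), §11 p. 67, (11.2). [cite: HeathBrownActa2001, §11 (11.2)]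
* D. R. Heath-Brown, B. Z. Moroz, Proc. London Math. Soc. 88 (2004), Prop. 4.2 (ii), (4.5).
  [cite: HeathBrownMoroz2004, Proposition 4.2]
-/

noncomputable section

open Polynomial NumberField Finset Filter Topology Asymptotics ArithmeticFunction

open scoped ArithmeticFunction.Moebius ArithmeticFunction.sigma

namespace Summit.Parity.GeneralizedHardyLittlewood.Theorems.GoldbachHeathBrownDispersionHeathBrownMorozUniform

open Literature.NumberTheory.Sieve.CubicSieve Literature.NumberTheory.Sieve.CubicPrimes
open Literature.NumberTheory.LFunctions.CubeRootTwoField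
open Literature.NumberTheory.Sieve

variable {X η τ V T : ℝ} {k : ℕ} {m : Fin k → ℕ} {c : Ideal (𝓞 K) → ℝ} {d a₀ b₀ : ℕ}

/-- `classPairs = (box.filter cls).filter coprime`. [cite: HeathBrownMoroz2004, Proposition 4.2] -/
theorem classPairs_eq_filter_filter (X η : ℝ) (d a₀ b₀ : ℕ) :
    classPairs X η d a₀ b₀ =
      ((box X η).filter (fun xy => xy.1 ≡ a₀ [MOD d] ∧ xy.2 ≡ b₀ [MOD d])).filter
        (fun xy => Nat.Coprime xy.1 xy.2) := by
  ext xy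
  rw [mem_classPairs_iff, boxPairs_eq_filter_box, mem_filter, mem_filter, mem_filter]
  tauto

open scoped Classical in
/-- **`S_V^{cl} = ∑_{(x,y) ∈ box, cls, (x,y)=1} Hprim(x, y)`** (passage to generators for the class sum;
for coprime `(x, y)` the vectors `α̂`, `β̂` are automatically primitive). [cite: HeathBrownActa2001, §11 pp. 67–68] -/
theorem classBilin_eq_sum_Hprim (hX : 0 ≤ X) (hT : 0 < T) :
    bilin (classPairs X η d a₀ b₀) pairIdeal c (gCut X τ m V) =
      ∑ xy ∈ ((box X η).filter (fun xy => xy.1 ≡ a₀ [MOD d] ∧ xy.2 ≡ b₀ [MOD d])).filter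
        (fun xy => Nat.Coprime xy.1 xy.2), Hprim X τ m V T c xy := by
  classical
  rw [bilin, classPairs_eq_filter_filter]
  refine sum_congr rfl fun xy hxy => ?_
  rw [mem_filter, mem_filter] at hxy
  obtain ⟨⟨hbox, -⟩, hcop⟩ := hxy
  have hx1 := (one_le_of_mem_box hX hbox).1
  have hγ : pairElt xy ≠ 0 := pairElt_ne_zero (by omega)
  rw [pairIdeal, sum_divisorPairs_eq_sum_winDivs hT hγ, Hprim]
  refine sum_congr rfl fun β hβ => ?_
  rw [mem_winDivs_iff hT hγ] at hβ
  have hq : quo (pairElt xy) β ∣ pairElt xy := ⟨β, by rw [mul_comm]; exact eq_mul_quo hβ.2⟩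
  rw [if_pos ⟨isPrimitiveVec_of_dvd_pairElt hcop hβ.2, isPrimitiveVec_of_dvd_pairElt hcop hq⟩]

open scoped Classical in
/-- **`S_V^{cl} = M_V^{cl} + E_V^{cl}`** (Möbius inversion over `gcd(x, y)` inside the class; the `g = 1` term is
the class main term `∑_{box, cls} Hprim`). [cite: HeathBrownMoroz2004, Proposition 4.2] -/
theorem classBilin_eq_main_add_error (hX : 0 ≤ X) (hT : 0 < T) :
    bilin (classPairs X η d a₀ b₀) pairIdeal c (gCut X τ m V) =
      ∑ xy ∈ (box X η).filter (fun xy => xy.1 ≡ a₀ [MOD d] ∧ xy.2 ≡ b₀ [MOD d]), Hprim X τ m V T c xy +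
      ∑ g ∈ Icc 2 ⌊X * (1 + η)⌋₊, (μ g : ℝ) *
        ∑ xy ∈ ((box X η).filter (fun xy => xy.1 ≡ a₀ [MOD d] ∧ xy.2 ≡ b₀ [MOD d])).filter
          (fun xy => g ∣ xy.1 ∧ g ∣ xy.2), Hprim X τ m V T c xy := by
  classical
  rw [classBilin_eq_sum_Hprim hX hT]
  set s := (box X η).filter (fun xy => xy.1 ≡ a₀ [MOD d] ∧ xy.2 ≡ b₀ [MOD d]) with hs
  set D : ℕ := ⌊X * (1 + η)⌋₊ with hD
  have hs_box : ∀ xy ∈ s, xy ∈ box X η := fun xy hxy => (mem_filter.mp hxy).1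
  have hbound : ∀ xy ∈ s, xy.1 ≤ D := fun xy hxy => by
    have := hs_box xy hxy; rw [mem_box_iff] at this; exact Nat.le_floor this.2.1
  rw [sum_filter_coprime_eq_sum_moebius s _ (fun xy hxy => (one_le_of_mem_box hX (hs_box xy hxy)).1) hbound]
  rcases Nat.eq_zero_or_pos D with hD0 | hDpos
  · have hse : s = ∅ := by
      rw [eq_empty_iff_forall_notMem]
      intro xy hxy
      have h1 := (one_le_of_mem_box hX (hs_box xy hxy)).1
      have h2 := hbound xy hxy
      omega
    simp [hse]
  · have hsplit : Icc 1 D = insert 1 (Icc 2 D) := by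
      ext g; simp only [mem_Icc, mem_insert]; omega
    rw [hsplit, sum_insert (by simp)]
    congr 1
    rw [ArithmeticFunction.moebius_apply_one, Int.cast_one, one_mul]
    refine sum_congr ?_ fun _ _ => rfl
    ext xy; simp

open scoped Classical in
/-- **`|E_V^{cl}| ≤ 9 ∑_{(x,y) ∈ box, gcd(x,y) ≥ X^τ} τ((x + y2^{1/3}))² τ(gcd(x, y))`** — the class error is
dominated by the tree's d = 1 majorant (the terms `g < X^τ` vanish, the class filter is dropped inside `|·|`).
[cite: HeathBrownActa2001, §11 (11.2)] -/
theorem abs_classError_le (hX : 1 < X) (hτ : 0 < τ) (hτ1 : τ ≤ 1) {n : ℕ} {m : Fin (n + 1) → ℕ}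
    (hm : CoreAdmissible τ m) (hc : CSupport X τ c) (hT : 0 < T) :
    |∑ g ∈ Icc 2 ⌊X * (1 + η)⌋₊, (μ g : ℝ) *
        ∑ xy ∈ ((box X η).filter (fun xy => xy.1 ≡ a₀ [MOD d] ∧ xy.2 ≡ b₀ [MOD d])).filter
          (fun xy => g ∣ xy.1 ∧ g ∣ xy.2), Hprim X τ m V T c xy| ≤
      9 * ∑ xy ∈ (box X η).filter (fun xy => X ^ τ ≤ (Nat.gcd xy.1 xy.2 : ℝ)),
        (idealDivisorCount (Ideal.span {pairElt xy}) : ℝ) ^ 2 * (σ 0 (Nat.gcd xy.1 xy.2) : ℝ) := by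
  classical
  have hX0 : 0 ≤ X := by linarith
  set D : ℕ := ⌊X * (1 + η)⌋₊ with hD
  set s := (box X η).filter (fun xy => xy.1 ≡ a₀ [MOD d] ∧ xy.2 ≡ b₀ [MOD d]) with hs
  have hterm : ∀ g ∈ Icc 2 D,
      |(μ g : ℝ) * ∑ xy ∈ s.filter (fun xy => g ∣ xy.1 ∧ g ∣ xy.2), Hprim X τ m V T c xy| ≤
        ∑ xy ∈ box X η, if g ∣ xy.1 ∧ g ∣ xy.2 ∧ X ^ τ ≤ (g : ℝ) then
          9 * (idealDivisorCount (Ideal.span {pairElt xy}) : ℝ) ^ 2 else 0 := by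
    intro g hg
    rw [mem_Icc] at hg
    rw [abs_mul]
    have hμ : |(μ g : ℝ)| ≤ 1 := by exact_mod_cast ArithmeticFunction.abs_moebius_le_one
    calc |(μ g : ℝ)| * |∑ xy ∈ s.filter (fun xy => g ∣ xy.1 ∧ g ∣ xy.2), Hprim X τ m V T c xy|
        ≤ 1 * ∑ xy ∈ s.filter (fun xy => g ∣ xy.1 ∧ g ∣ xy.2), |Hprim X τ m V T c xy| :=
          mul_le_mul hμ (abs_sum_le_sum_abs _ _) (abs_nonneg _) zero_le_one
      _ ≤ ∑ xy ∈ (box X η).filter (fun xy => g ∣ xy.1 ∧ g ∣ xy.2), |Hprim X τ m V T c xy| := by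
          rw [one_mul]
          refine sum_le_sum_of_subset_of_nonneg (fun xy hxy => ?_) (fun _ _ _ => abs_nonneg _)
          rw [mem_filter, hs, mem_filter] at hxy
          exact mem_filter.mpr ⟨hxy.1.1, hxy.2⟩
      _ = ∑ xy ∈ box X η, if g ∣ xy.1 ∧ g ∣ xy.2 then |Hprim X τ m V T c xy| else 0 := by
          rw [sum_filter]
      _ ≤ _ := by
          refine sum_le_sum fun xy hxy => ?_
          have hx1 := (one_le_of_mem_box hX0 hxy).1
          by_cases hdvd : g ∣ xy.1 ∧ g ∣ xy.2
          · rw [if_pos hdvd]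
            by_cases hdX : X ^ τ ≤ (g : ℝ)
            · rw [if_pos ⟨hdvd.1, hdvd.2, hdX⟩]
              exact abs_Hprim_le hX hτ hτ1 hm hc hT (by omega)
            · rw [if_neg (fun h => hdX h.2.2)]
              push Not at hdX
              rw [Hprim_eq_zero_of_dvd hc hT hg.1 hdX (by omega) hdvd.1 hdvd.2, abs_zero]
          · rw [if_neg hdvd, if_neg (fun h => hdvd ⟨h.1, h.2.1⟩)]
  refine (abs_sum_le_sum_abs _ _).trans ((sum_le_sum hterm).trans ?_)
  rw [sum_comm, mul_sum, sum_filter]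
  refine sum_le_sum fun xy hxy => ?_
  have hx1 := (one_le_of_mem_box hX0 hxy).1
  set g₀ : ℕ := Nat.gcd xy.1 xy.2 with hg₀
  have hg0 : g₀ ≠ 0 := by rw [hg₀, Ne, Nat.gcd_eq_zero_iff]; omega
  have hsub : ∀ g ∈ Icc 2 D, g ∣ xy.1 ∧ g ∣ xy.2 ∧ X ^ τ ≤ (g : ℝ) → g ∈ g₀.divisors ∧ X ^ τ ≤ (g₀ : ℝ) := by
    intro g _ ⟨h1, h2, h3⟩
    have hdg : g ∣ g₀ := Nat.dvd_gcd h1 h2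
    refine ⟨Nat.mem_divisors.mpr ⟨hdg, hg0⟩, h3.trans ?_⟩
    exact_mod_cast Nat.le_of_dvd (Nat.pos_of_ne_zero hg0) hdg
  by_cases hG : X ^ τ ≤ (g₀ : ℝ)
  · rw [if_pos hG]
    calc ∑ g ∈ Icc 2 D, (if g ∣ xy.1 ∧ g ∣ xy.2 ∧ X ^ τ ≤ (g : ℝ) then
            9 * (idealDivisorCount (Ideal.span {pairElt xy}) : ℝ) ^ 2 else 0)
        ≤ ∑ g ∈ g₀.divisors, 9 * (idealDivisorCount (Ideal.span {pairElt xy}) : ℝ) ^ 2 := by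
          rw [← sum_filter]
          refine sum_le_sum_of_subset_of_nonneg (fun g hg => ?_) (fun _ _ _ => by positivity)
          rw [mem_filter] at hg
          exact (hsub g hg.1 hg.2).1
      _ = 9 * ((idealDivisorCount (Ideal.span {pairElt xy}) : ℝ) ^ 2 * (σ 0 g₀ : ℝ)) := by
          rw [sum_const, nsmul_eq_mul, ArithmeticFunction.sigma_zero_apply]; ring
  · rw [if_neg hG]
    refine (sum_eq_zero fun g hg => ?_).le
    rw [if_neg]
    intro h
    exact hG (hsub g hg h).2

open scoped Classical in
/-- **Stub E3 `stub_classMainError` of crux `HeathBrownMorozUniform` (line `unit-split-positivity`), PROVED.**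
`S_V^{cl} = M_V^{cl} + E_V^{cl}` with `|E_V^{cl}| ≤ C X² (X^τ)^{-1/2} (log X)^e`, absolute `C, e` — the class
error is termwise dominated by the d = 1 majorant, bounded as in the tree's `exists_errorEV_bound`
(Cauchy–Schwarz, Lemma 4.7 with `A = 4`, the elementary gcd count). [cite: HeathBrownMoroz2004, Proposition 4.2]
[cite: HeathBrownActa2001, §11 (11.2)] -/
theorem stub_classMainError :
  ∃ C e : ℝ, 0 < C ∧ 0 ≤ e ∧
    ∀ (X η τ V T : ℝ) (n : ℕ) (m : Fin (n + 1) → ℕ) (c : Ideal (𝓞 K) → ℝ) (d a₀ b₀ : ℕ),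
      2 ≤ X → 0 ≤ η → η ≤ 1 → 0 < τ → τ ≤ 1 → 0 < T → CoreAdmissible τ m → CSupport X τ c →
        |bilin (classPairs X η d a₀ b₀) pairIdeal c (gCut X τ m V) -
            ∑ xy ∈ (box X η).filter (fun xy => xy.1 ≡ a₀ [MOD d] ∧ xy.2 ≡ b₀ [MOD d]),
              Hprim X τ m V T c xy| ≤
          C * X ^ 2 * (X ^ τ) ^ (-(1 / 2 : ℝ)) * Real.log X ^ e := by
  classical
  obtain ⟨C₄, e₄, hC₄, he₄, h47⟩ := HeathBrown2001_lemma_4_7 4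
  obtain ⟨C₂, hC₂, hdiv⟩ := exists_sum_sigma_zero_pow_div_le_real 2
  set CA : ℝ := C₄ * 4 * 4 ^ e₄ with hCA
  set CB : ℝ := 4 * C₂ * 2 ^ 8 with hCB
  refine ⟨9 * Real.sqrt CA * Real.sqrt CB, e₄ / 2 + 4, by positivity, by positivity, ?_⟩
  intro X η τ V T n m c d a₀ b₀ hX hη0 hη1 hτ hτ1 hT hm hc
  have hX1 : 1 < X := by linarith
  have hX0 : 0 ≤ X := by linarith
  -- `S^{cl} − M^{cl} = E^{cl}`, dominated by the d = 1 majorant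
  rw [classBilin_eq_main_add_error (η := η) (T := T) hX0 hT, add_sub_cancel_left]
  refine (abs_classError_le (η := η) (V := V) hX1 hτ hτ1 hm hc hT).trans ?_
  -- Cauchy–Schwarz
  set F := (box X η).filter (fun xy => X ^ τ ≤ (Nat.gcd xy.1 xy.2 : ℝ)) with hF
  have hcs := Real.sum_mul_le_sqrt_mul_sqrt F (fun xy => (idealDivisorCount (Ideal.span {pairElt xy}) : ℝ) ^ 2)
    (fun xy => (σ 0 (Nat.gcd xy.1 xy.2) : ℝ))
  have hmono : Real.sqrt (∑ xy ∈ F, ((idealDivisorCount (Ideal.span {pairElt xy}) : ℝ) ^ 2) ^ 2) ≤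
      Real.sqrt (∑ xy ∈ box X η, (idealDivisorCount (Ideal.span {pairElt xy}) : ℝ) ^ 4) := by
    apply Real.sqrt_le_sqrt
    simp_rw [← pow_mul]
    exact sum_le_sum_of_subset_of_nonneg (filter_subset _ _) fun _ _ _ => by positivity
  have hE : 9 * ∑ xy ∈ F, (idealDivisorCount (Ideal.span {pairElt xy}) : ℝ) ^ 2 * (σ 0 (Nat.gcd xy.1 xy.2) : ℝ) ≤
      9 * Real.sqrt (∑ xy ∈ box X η, (idealDivisorCount (Ideal.span {pairElt xy}) : ℝ) ^ 4) *
        Real.sqrt (∑ xy ∈ F, (σ 0 (Nat.gcd xy.1 xy.2) : ℝ) ^ 2) := by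
    rw [mul_assoc]
    refine mul_le_mul_of_nonneg_left (hcs.trans ?_) (by norm_num)
    exact mul_le_mul_of_nonneg_right hmono (Real.sqrt_nonneg _)
  refine hE.trans ?_
  -- the two factors (verbatim the tree's `exists_errorEV_bound`)
  set N : ℕ := ⌊X * (1 + η)⌋₊ with hN
  have hNX : (N : ℝ) ≤ 2 * X := by
    have : (N : ℝ) ≤ X * (1 + η) := Nat.floor_le (by positivity)
    nlinarith
  have hN2 : 2 ≤ N := Nat.le_floor (by push_cast; nlinarith)
  have hN2r : (2 : ℝ) ≤ N := by exact_mod_cast hN2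
  have hlogX : 0 < Real.log X := Real.log_pos hX1
  have hlog2 : Real.log 2 ≤ Real.log X := Real.log_le_log two_pos hX
  have hlogN : Real.log N ≤ 2 * Real.log X := by
    calc Real.log N ≤ Real.log (2 * X) := Real.log_le_log (by positivity) hNX
      _ = Real.log 2 + Real.log X := Real.log_mul two_ne_zero (by positivity)
      _ ≤ 2 * Real.log X := by linarith
  have hlogN0 : 0 ≤ Real.log N := Real.log_nonneg (by linarith)
  have hA : ∑ xy ∈ box X η, (idealDivisorCount (Ideal.span {pairElt xy}) : ℝ) ^ 4 ≤
      CA * X ^ 2 * Real.log X ^ e₄ := by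
    refine (sum_box_idealDivisorCount_pow_le 4 hX0).trans ((h47 N N hN2 le_rfl).trans ?_)
    have hlogNN : Real.log ((N : ℝ) * N) ≤ 4 * Real.log X := by
      rw [Real.log_mul (by positivity) (by positivity)]; linarith
    have hlogNN0 : 0 ≤ Real.log ((N : ℝ) * N) := Real.log_nonneg (by nlinarith)
    calc C₄ * N * N * Real.log ((N : ℝ) * N) ^ e₄ ≤ C₄ * (2 * X) * (2 * X) * (4 * Real.log X) ^ e₄ := by
          gcongr
      _ = CA * X ^ 2 * Real.log X ^ e₄ := by
          rw [hCA, Real.mul_rpow (by norm_num) hlogX.le]; ring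
  have hXτ1 : 1 ≤ X ^ τ := Real.one_le_rpow hX1.le hτ.le
  have hXτpos : 0 < X ^ τ := by positivity
  have hB : ∑ xy ∈ F, (σ 0 (Nat.gcd xy.1 xy.2) : ℝ) ^ 2 ≤ CB * X ^ 2 * (X ^ τ)⁻¹ * Real.log X ^ (8 : ℝ) := by
    refine (sum_box_gcd_ge_sigma_sq_le hX0 hXτ1).trans ?_
    have h2 := hdiv N hN2r
    rw [Nat.floor_natCast] at h2
    have hXτ0 : 0 < (X ^ τ)⁻¹ := by positivity
    calc (N : ℝ) ^ 2 * (X ^ τ)⁻¹ * ∑ g ∈ Icc 1 N, (σ 0 g : ℝ) ^ 2 / g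
        ≤ (2 * X) ^ 2 * (X ^ τ)⁻¹ * (C₂ * Real.log N ^ (2 ^ (2 + 1))) := by gcongr
      _ ≤ (2 * X) ^ 2 * (X ^ τ)⁻¹ * (C₂ * (2 * Real.log X) ^ (2 ^ (2 + 1))) := by gcongr
      _ = CB * X ^ 2 * (X ^ τ)⁻¹ * Real.log X ^ (8 : ℝ) := by
          rw [hCB, show ((8 : ℝ)) = ((8 : ℕ) : ℝ) by norm_num, Real.rpow_natCast]; ring
  have eA : (Real.log X ^ (e₄ / 2)) ^ 2 = Real.log X ^ e₄ := by
    rw [← Real.rpow_natCast, ← Real.rpow_mul hlogX.le]; congr 1; push_cast; ring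
  have eB : ((X ^ τ) ^ (-(1 / 2 : ℝ))) ^ 2 = (X ^ τ)⁻¹ := by
    rw [← Real.rpow_natCast, ← Real.rpow_mul hXτpos.le,
      show (-(1 / 2 : ℝ)) * ((2 : ℕ) : ℝ) = -1 by push_cast; ring, Real.rpow_neg_one]
  have e8 : (Real.log X ^ (4 : ℝ)) ^ 2 = Real.log X ^ (8 : ℝ) := by
    rw [← Real.rpow_natCast, ← Real.rpow_mul hlogX.le]; norm_num
  have hsA : Real.sqrt (CA * X ^ 2 * Real.log X ^ e₄) = Real.sqrt CA * X * Real.log X ^ (e₄ / 2) := by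
    rw [show CA * X ^ 2 * Real.log X ^ e₄ = (Real.sqrt CA * X * Real.log X ^ (e₄ / 2)) ^ 2 by
      rw [mul_pow, mul_pow, Real.sq_sqrt (by positivity), eA], Real.sqrt_sq (by positivity)]
  have hsB : Real.sqrt (CB * X ^ 2 * (X ^ τ)⁻¹ * Real.log X ^ (8 : ℝ)) =
      Real.sqrt CB * X * (X ^ τ) ^ (-(1 / 2 : ℝ)) * Real.log X ^ (4 : ℝ) := by
    rw [show CB * X ^ 2 * (X ^ τ)⁻¹ * Real.log X ^ (8 : ℝ) =
      (Real.sqrt CB * X * (X ^ τ) ^ (-(1 / 2 : ℝ)) * Real.log X ^ (4 : ℝ)) ^ 2 by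
      rw [mul_pow, mul_pow, mul_pow, Real.sq_sqrt (by positivity), eB, e8], Real.sqrt_sq (by positivity)]
  have hsqA : Real.sqrt (∑ xy ∈ box X η, (idealDivisorCount (Ideal.span {pairElt xy}) : ℝ) ^ 4) ≤
      Real.sqrt CA * X * Real.log X ^ (e₄ / 2) := hsA ▸ Real.sqrt_le_sqrt hA
  have hsqB : Real.sqrt (∑ xy ∈ F, (σ 0 (Nat.gcd xy.1 xy.2) : ℝ) ^ 2) ≤
      Real.sqrt CB * X * (X ^ τ) ^ (-(1 / 2 : ℝ)) * Real.log X ^ (4 : ℝ) := hsB ▸ Real.sqrt_le_sqrt hB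
  have hpow : Real.log X ^ (e₄ / 2) * Real.log X ^ (4 : ℝ) = Real.log X ^ (e₄ / 2 + 4) := by
    rw [← Real.rpow_add hlogX]
  calc 9 * Real.sqrt (∑ xy ∈ box X η, (idealDivisorCount (Ideal.span {pairElt xy}) : ℝ) ^ 4) *
        Real.sqrt (∑ xy ∈ F, (σ 0 (Nat.gcd xy.1 xy.2) : ℝ) ^ 2)
      ≤ 9 * (Real.sqrt CA * X * Real.log X ^ (e₄ / 2)) *
          (Real.sqrt CB * X * (X ^ τ) ^ (-(1 / 2 : ℝ)) * Real.log X ^ (4 : ℝ)) := by gcongr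
    _ = 9 * Real.sqrt CA * Real.sqrt CB * X ^ 2 * (X ^ τ) ^ (-(1 / 2 : ℝ)) *
          (Real.log X ^ (e₄ / 2) * Real.log X ^ (4 : ℝ)) := by ring
    _ = 9 * Real.sqrt CA * Real.sqrt CB * X ^ 2 * (X ^ τ) ^ (-(1 / 2 : ℝ)) * Real.log X ^ (e₄ / 2 + 4) := by
        rw [hpow]

end Summit.Parity.GeneralizedHardyLittlewood.Theorems.GoldbachHeathBrownDispersionHeathBrownMorozUniform

end
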